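import Summits.BirchSwinnertonDyer.BirchSwinnertonDyer.Theorems.ByReductionTypeAtTwoAdditiveRankZeroResidualGlueMember
import Literature.NumberTheory.EllipticCurves.KubertTateNineBadPrimes
import HarnessLib

/-!
# Crux `AdditiveRankZeroAtTwo` (K4 item 19098): the KATO HALF at `2` on the WHOLE additive potentially-good class
# and the crux's ONE-SIDED residual (glue v4) — seat `bsd-2adic-addL2x` GEN 11

Cell `bsd-2adic`, rung K4, crux stmt-BirchSwinnertonDyer-19098, line add_twist_overK v2. `--supports 19098 --as helper`.
HONEST FRAMING (D-0036/D-0054): assembly-shaped CONDITIONAL theorems; every research-grade input is displayed; closes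
nothing at the `∀`-level; nothing booked; BSD is not proved by any of this.

WHAT THIS FILE DOES. The curve-level Kato-at-`2` doors of GEN 8/10 —
`padicValNat_shaOrder_le_of_katoFineSelmerAtTwoSharp_rankZero` (irreducible `E[2]`, statement (A) at `(E,2)`; the SHARP
reading `hSharp`) and `missingUpperBoundAt_two_of_katoMember_two` (reducible `E[2]`; the member reading
`Kato2004.exists_memberHullInputs_two` + Cassels + Cassels–Tate; side conditions «every isogenous member has `2`-primary
torsion of order `∤ 4`» and «`ord₂ #Ш_an` even») — carry NO semistability-defect hypothesis: they ask only «additive at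
`2`» and «`0 ≤ ord₂ j`» (potentially good). The block-level wrappers of GEN 9/10 restricted them to `DefectAtLeastThree`
(1 382 census classes) because the line add_twist_overK routes the quadratically semistabilisable sub-class (563 classes
= 463 potentially multiplicative + 100 potentially good with `Φ(E,2) = C₂`) through lane A's over-`K` stub. Here:

* §1 `padicValRat_j_nonneg_of_good` — good reduction at `p` ⇒ `0 ≤ ord_p j` (from the tree's
  `norm_j_le_one_of_hasGoodReductionAtPrime`); hence a semistable quadratic twist of a potentially MULTIPLICATIVE curve is
  multiplicative (`mult_of_semistableTwist_of_padicValRat_j_neg`).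
* §2 `addPotGoodUpper_two_of_conjA_of_rest` — the KATO HALF `MissingUpperBoundAt W 2` for EVERY non-CM globally minimal
  `W` of analytic rank `0`, additive and potentially good at `2` (C₂ sub-class INCLUDED), from PRINT {GZK, modularity ×2,
  Lim@2, FW, Cassels, Cassels–Tate} + READINGS {`hSharp`, `hin`} + (I1) statement (A) at `2` on the curves whose `2`-division
  field is NOT abelian over `ℚ` + (I2) the displayed remainder on the reducible curves failing the side conditions.
* §3 `addPotGood_bsdp_two_of_kato_of_lower` — on the same class, BSD₂ from the Kato half and the EISENSTEIN HALF
  `MissingLowerBoundAt W 2` over `ℚ` (the 19272-shaped object; per class = the cell's Cassels–Tate certificates or a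
  `2`-adic unit `#Ш_an`), by `missingPPartAt_of_lower_of_upper` + `bsdp_of_missingPPartAt`; and the converse
  `missingLowerBoundAt_of_bsdp` direction recorded as `addPotGood_bsdp_two_iff_lower_of_kato` (the glue is not lossy).
* §4 `addPotMult_bsdp_two_of_mult_of_overKC` — the potentially MULTIPLICATIVE sub-class through lane A's road with the
  SINGLE sibling `MultiplicativeRankZeroAtTwo` (the Hoffstein–Luo semistable twist is multiplicative by §1) and lane A's
  over-`K` stub RESTRICTED to `ord₂ j < 0`.
* §5 `additiveRankZeroAtTwo_of_residual_v4` — the crux BY NAME (type = the route decl verbatim), ONE-SIDED: PRINT {GZK,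
  modularity ×2, Milne any-model, Hoffstein–Luo, Lim@2, FW, Cassels, Cassels–Tate} + READINGS {`hSharp`, `hin`} + sibling
  {`hMult`} + (I1″) (A)@2 on non-abelian `ℚ(E[2])`, additive pot-good + (I2″) reducible pot-good side-condition failures +
  (I3″) the Eisenstein half over `ℚ` on additive pot-good `r_an = 0` + (I4″) lane A's over-`K` stub on the pot-mult
  sub-class. Compared with v3 (`additiveRankZeroAtTwo_of_residual_v3`, GEN 10): `hKC` (full BSD₂ over every admissible
  INERT quadratic field on the defect-≥3 block), `hMM` (Murty–Murty), `hOrd`, `hSS` are GONE; lane A's stub shrinks from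
  563 to 463 classes; the research residual on the 1 482 potentially-good classes is one-sided (lower halves only).

References: [Kato2004Asterisque] Thm. 12.4–12.6, 13.8, §14.14, Prop. 14.16 (2); [CoatesSujatha2005] statement (A);
[Lim2017FineSelmer] Thm. 3.5; [FerreroWashington1979]; [Cassels1965ArithmeticVIII]; [SilvermanAEC2009] VII.5.1, VII.5.5,
X.4.14; [Milne1972ArithmeticAV] Thm. 1; [HoffsteinLuo1997]; [Miller2011LMS] Def. 1.1.
-/

set_option autoImplicit false
set_option linter.dupNamespace false

noncomputable section

open scoped Classical

namespace Summit.BirchSwinnertonDyer.BirchSwinnertonDyer.Theorems.AddKatoTwo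

open WeierstrassCurve Literature.NumberTheory.EllipticCurves
  Literature.NumberTheory.EllipticCurves.ModularForms
  Literature.NumberTheory.EllipticCurves.Kato2004
  Literature.NumberTheory.EllipticCurves.Rank1Residual
  Literature.NumberTheory.EllipticCurves.Rank1Residual.Typed
  Literature.NumberTheory.IwasawaTheory
  Summit.BirchSwinnertonDyer.Rank1Residual Summit.BirchSwinnertonDyer.Rank1Residual.AdditivePotMult
  Summit.BirchSwinnertonDyer.Rank1Residual.X5.AddTwoL2
  Summit.BirchSwinnertonDyer.BirchSwinnertonDyer.Theses.ByReductionTypeAtTwo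

/-! ## §1 Good reduction ⇒ `ord_p j ≥ 0`; a semistable twist of a potentially multiplicative curve is multiplicative -/

/-- **Good reduction at `p` forces `0 ≤ ord_p j(E)`** (Silverman *AEC* VII.5.1 (a) / VII.5.5: the `ℤ_p`-minimal model has
integral `c₄` and unit `Δ`), read off the tree's `norm_j_le_one_of_hasGoodReductionAtPrime` (`‖j‖_p ≤ 1`) through
`‖q‖_p = p^{−ord_p q}`. [cite: SilvermanAEC2009, Prop. VII.5.1 (a) and Prop. VII.5.5] -/
theorem padicValRat_j_nonneg_of_good (W : WeierstrassCurve ℚ) [W.IsElliptic] (p : ℕ) [Fact p.Prime]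
    (h : W.HasGoodReductionAtPrime p) : 0 ≤ padicValRat p W.j := by
  by_cases hj0 : W.j = 0
  · simp [hj0]
  have h1 := norm_j_le_one_of_hasGoodReductionAtPrime W h
  rw [Padic.eq_padicNorm] at h1
  have h2 : padicNorm p W.j ≤ 1 := by exact_mod_cast h1
  rw [padicNorm.eq_zpow_of_nonzero hj0] at h2
  by_contra hlt
  have hlt' : padicValRat p W.j < 0 := lt_of_not_ge hlt
  have hp : (1 : ℚ) < p := by exact_mod_cast (Fact.out : p.Prime).one_lt
  have h3 : (1 : ℚ) < (p : ℚ) ^ (-padicValRat p W.j) := one_lt_zpow₀ hp (by omega)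
  linarith

/-- **A semistable quadratic twist of a potentially multiplicative curve is multiplicative.** If `W` is additive at `2`
with `ord₂ j < 0` and `Wd` is any model of the twist `W^{(d)}` (`d ≠ 0`) which is good-ordinary, good-supersingular or
multiplicative at `2`, then `Wd` is multiplicative at `2`: `j(Wd) = j(W)` and good reduction would force `ord₂ j ≥ 0`.
[cite: SilvermanAEC2009, Prop. VII.5.1 and Prop. VII.5.5] -/
theorem mult_of_semistableTwist_of_padicValRat_j_neg (W : WeierstrassCurve ℚ) [W.IsElliptic]
    (hj : padicValRat 2 W.j < 0) {d : ℚ} (hd : d ≠ 0)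
    (Wd : WeierstrassCurve ℚ) [Wd.IsElliptic] [Wd.IsGloballyMinimal]
    (hWd : ∃ C : VariableChange ℚ, C • W.quadraticTwist d = Wd)
    (hred : GoodOrd Wd 2 ∨ GoodSS Wd 2 ∨ Mult Wd 2) : Mult Wd 2 := by
  haveI : Fact (Nat.Prime 2) := ⟨Nat.prime_two⟩
  obtain ⟨C, rfl⟩ := hWd
  haveI := W.isElliptic_quadraticTwist hd
  have hjWd : (C • W.quadraticTwist d).j = W.j := by
    rw [(W.quadraticTwist d).variableChange_j C, W.j_quadraticTwist hd]
  have hng : ¬ (C • W.quadraticTwist d).HasGoodReductionAtPrime 2 := by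
    intro hg
    have h0 := padicValRat_j_nonneg_of_good (C • W.quadraticTwist d) 2 hg
    rw [hjWd] at h0
    exact absurd hj (not_lt.mpr h0)
  rcases hred with hgo | hss | hm
  · exact absurd hgo.1 hng
  · exact absurd hss.1 hng
  · exact hm

/-! ## §2 The KATO HALF at `2` on the whole additive potentially-good class -/

/-- **Statement (A) at `2` on the additive potentially-good class IS statement (A) on its non-abelian-`ℚ(E[2])` part**,
granted Lim@2 + Ferrero–Washington BY NAME (`conjA_two_of_isAbelianGalois_divisionField_two`, GEN 9: abelian `ℚ(E[2])`
— reducible `E[2]` or cyclic-cubic image — ⇒ (A) from print). Conditional; nothing about the `S₃` case is asserted.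
[cite: CoatesSujatha2005, statement (A) and Cor. 3.6] [cite: Lim2017FineSelmer, §3 Thm. 3.5] [cite: FerreroWashington1979, Theorem] -/
theorem addPotGood_conjA_two_of_nonAbelian
    (hLim2 : Lim2017.thm35_at_two_fineSelmerDual_moduleFinite_of_classicalMuVanishes_of_le_divisionField_four)
    (hFW : ferreroWashington1979_classicalMuVanishes)
    (hAna : ∀ (W : WeierstrassCurve ℚ) [W.IsElliptic] [W.IsGloballyMinimal], ¬ W.HasCM → W.analyticRank = 0 →
      Addv W 2 → 0 ≤ padicValRat 2 W.j → ¬ IsAbelianGalois ℚ (W.divisionField 2) →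
      ∀ (κ : ZpExtension ℚ 2), κ.IsCyclotomic →
        ∃ (γ : Field.absoluteGaloisGroup ℚ) (D : W.FineSelmerDualData κ γ),
          Module.Finite ℤ_[2] (RestrictScalars ℤ_[2] (IwasawaAlgebra 2) D.X)) :
    ∀ (W : WeierstrassCurve ℚ) [W.IsElliptic] [W.IsGloballyMinimal], ¬ W.HasCM → W.analyticRank = 0 →
      Addv W 2 → 0 ≤ padicValRat 2 W.j →
      ∀ (κ : ZpExtension ℚ 2), κ.IsCyclotomic →
        ∃ (γ : Field.absoluteGaloisGroup ℚ) (D : W.FineSelmerDualData κ γ),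
          Module.Finite ℤ_[2] (RestrictScalars ℤ_[2] (IwasawaAlgebra 2) D.X) := by
  intro W _ _ hcm hr hadd hj
  by_cases hab : IsAbelianGalois ℚ (W.divisionField 2)
  · exact conjA_two_of_isAbelianGalois_divisionField_two hLim2 hFW W
  · exact hAna W hcm hr hadd hj hab

/-- **The KATO HALF at `2` on the WHOLE additive potentially-good class** (C₂ quadratic sub-class included). For every
non-CM globally minimal `W/ℚ` of analytic rank `0`, additive at `2` with `0 ≤ ord₂ j`: `MissingUpperBoundAt W 2`
(`ord₂ #Ш ≤ ord₂ #Ш_an`), GRANTED — PRINT: GZK (`hGZK`), modularity (`hmod`, `hmodN`), Lim@2 (`hLim2`), Ferrero–Washington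
(`hFW`), Cassels (`hCassels`), Cassels–Tate (`hCT`); READINGS: the sharp Kato-at-`2` reading for irreducible `E[2]`
(`hSharp`, D-audit PASS) and Kato's member reading for reducible `E[2]` (`hin`, D-audit owed); DISPLAYED: (I1″) statement
(A) of Coates–Sujatha at `(W,2)` on the curves of the class whose `2`-division field is NOT abelian over `ℚ` (`hAna`), and
(I2″) the upper half itself on the reducible curves of the class failing «every isogenous member has `2`-primary torsion
of order `∤ 4`» ∧ «`ord₂ #Ш_an` even» (`hRest`). Proof: irreducible `E[2]` ⇒ (A) at `(W,2)` (print if `ℚ(E[2])` abelian,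
else `hAna`) ⇒ the sharp door with torsion term `0`; reducible ⇒ Kato's member door or `hRest`. The doors used carry no
defect hypothesis. Conditional; closes nothing.
[cite: Kato2004Asterisque, Thm. 12.5 (1)(3) (pp. 221–222), 13.8 (pp. 227–229), 14.14 (p. 243), Prop. 14.16 (2) (p. 244)]
[cite: CoatesSujatha2005, statement (A)] [cite: Cassels1965ArithmeticVIII] [cite: SilvermanAEC2009, Thm. X.4.14]
[cite: Miller2011LMS, Def. 1.1] -/
theorem addPotGoodUpper_two_of_conjA_of_rest
    (hGZK : rank_eq_analyticRank_of_analyticRank_le_one) (hmod : hasEntireLFunction_rat) (hmodN : exists_isNewformOf)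
    (hLim2 : Lim2017.thm35_at_two_fineSelmerDual_moduleFinite_of_classicalMuVanishes_of_le_divisionField_four)
    (hFW : ferreroWashington1979_classicalMuVanishes)
    (hCassels : bsdRHS_eq_of_isIsogenous) (hCT : exists_casselsTate_pairing (K := ℚ))
    (hSharp : Kato2004.rankZero_padicValNat_sha_add_padicValNat_tamagawa_le_at_two_of_irreducible_of_fineSelmerDual_fg)
    (hin : Kato2004.exists_memberHullInputs_two)
    (hAna : ∀ (W : WeierstrassCurve ℚ) [W.IsElliptic] [W.IsGloballyMinimal], ¬ W.HasCM → W.analyticRank = 0 →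
      Addv W 2 → 0 ≤ padicValRat 2 W.j → ¬ IsAbelianGalois ℚ (W.divisionField 2) →
      ∀ (κ : ZpExtension ℚ 2), κ.IsCyclotomic →
        ∃ (γ : Field.absoluteGaloisGroup ℚ) (D : W.FineSelmerDualData κ γ),
          Module.Finite ℤ_[2] (RestrictScalars ℤ_[2] (IwasawaAlgebra 2) D.X))
    (hRest : ∀ (W : WeierstrassCurve ℚ) [W.IsElliptic] [W.IsGloballyMinimal], ¬ W.HasCM → W.analyticRank = 0 →
      Addv W 2 → 0 ≤ padicValRat 2 W.j → ¬ W.HasIrreducibleModPGaloisRep 2 →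
      ¬ ((∀ (W' : WeierstrassCurve ℚ) [W'.IsElliptic], IsIsogenous W W' → ¬ 2 ^ 2 ∣ W'.torsionOrder) ∧
          (∀ q : ℚ, shaAn W = (q : ℂ) → Even (padicValRat 2 q))) →
      MissingUpperBoundAt W 2) :
    ∀ (W : WeierstrassCurve ℚ) [W.IsElliptic] [W.IsGloballyMinimal], ¬ W.HasCM → W.analyticRank = 0 →
      Addv W 2 → 0 ≤ padicValRat 2 W.j → MissingUpperBoundAt W 2 := by
  intro W _ _ hcm hr hadd hj
  haveI : Fact (Nat.Prime 2) := ⟨Nat.prime_two⟩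
  by_cases hirr : W.HasIrreducibleModPGaloisRep 2
  · -- irreducible `E[2]`: (A) at `(W,2)` + the sharp door, torsion term `0`
    have hA := addPotGood_conjA_two_of_nonAbelian hLim2 hFW hAna W hcm hr hadd hj
    obtain ⟨q, hq, hle⟩ :=
      padicValNat_shaOrder_le_of_katoFineSelmerAtTwoSharp_rankZero hSharp hGZK hmod W hcm hadd.1 hadd.2 hj hirr hA hr
    rw [padicValNat_torsionOrder_eq_zero_of_irreducible W 2 hirr] at hle
    simp only [Nat.cast_zero, mul_zero, sub_zero] at hle
    exact ⟨q, hq, hle⟩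
  · -- reducible `E[2]`: Kato's member door or the displayed remainder
    by_cases hside : (∀ (W' : WeierstrassCurve ℚ) [W'.IsElliptic], IsIsogenous W W' → ¬ 2 ^ 2 ∣ W'.torsionOrder) ∧
        (∀ q : ℚ, shaAn W = (q : ℂ) → Even (padicValRat 2 q))
    · exact missingUpperBoundAt_two_of_katoMember_two hmodN hin hLim2 hFW hCassels hCT hGZK hmod W hcm hadd.1 hadd.2
        hj hirr hr (fun W' _ hiso => hside.1 W' hiso) hside.2
    · exact hRest W hcm hr hadd hj hirr hside

/-! ## §3 BSD₂ on the additive potentially-good class from the Kato half and the EISENSTEIN half over `ℚ` -/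

/-- **BSD₂ on the additive potentially-good class from the Kato half (§2) and the displayed EISENSTEIN HALF
`MissingLowerBoundAt W 2` over `ℚ`** (`hLow`: `ord₂ #Ш_an ≤ ord₂ #Ш` for every non-CM globally minimal `W` of analytic rank
`0`, additive and potentially good at `2` — the object of the same shape as item 19272 `OrdEisensteinHalfAtTwo`; per
class it is the cell's Cassels–Tate / `2^k`-descent certificate, and trivial when `#Ш_an` is a `2`-adic unit). Glue:
`missingPPartAt_of_lower_of_upper` + `bsdp_of_missingPPartAt` (GZK). No quadratic field, no twist, no sibling crux enters
on this class. Conditional; closes nothing. [cite: Kato2004Asterisque, Thm. 12.5 (1)(3), Prop. 14.16 (2)]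
[cite: CoatesSujatha2005, statement (A)] [cite: Miller2011LMS, §1 and Def. 1.1] -/
theorem addPotGood_bsdp_two_of_kato_of_lower
    (hGZK : rank_eq_analyticRank_of_analyticRank_le_one) (hmod : hasEntireLFunction_rat) (hmodN : exists_isNewformOf)
    (hLim2 : Lim2017.thm35_at_two_fineSelmerDual_moduleFinite_of_classicalMuVanishes_of_le_divisionField_four)
    (hFW : ferreroWashington1979_classicalMuVanishes)
    (hCassels : bsdRHS_eq_of_isIsogenous) (hCT : exists_casselsTate_pairing (K := ℚ))
    (hSharp : Kato2004.rankZero_padicValNat_sha_add_padicValNat_tamagawa_le_at_two_of_irreducible_of_fineSelmerDual_fg)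
    (hin : Kato2004.exists_memberHullInputs_two)
    (hAna : ∀ (W : WeierstrassCurve ℚ) [W.IsElliptic] [W.IsGloballyMinimal], ¬ W.HasCM → W.analyticRank = 0 →
      Addv W 2 → 0 ≤ padicValRat 2 W.j → ¬ IsAbelianGalois ℚ (W.divisionField 2) →
      ∀ (κ : ZpExtension ℚ 2), κ.IsCyclotomic →
        ∃ (γ : Field.absoluteGaloisGroup ℚ) (D : W.FineSelmerDualData κ γ),
          Module.Finite ℤ_[2] (RestrictScalars ℤ_[2] (IwasawaAlgebra 2) D.X))
    (hRest : ∀ (W : WeierstrassCurve ℚ) [W.IsElliptic] [W.IsGloballyMinimal], ¬ W.HasCM → W.analyticRank = 0 →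
      Addv W 2 → 0 ≤ padicValRat 2 W.j → ¬ W.HasIrreducibleModPGaloisRep 2 →
      ¬ ((∀ (W' : WeierstrassCurve ℚ) [W'.IsElliptic], IsIsogenous W W' → ¬ 2 ^ 2 ∣ W'.torsionOrder) ∧
          (∀ q : ℚ, shaAn W = (q : ℂ) → Even (padicValRat 2 q))) →
      MissingUpperBoundAt W 2)
    (hLow : ∀ (W : WeierstrassCurve ℚ) [W.IsElliptic] [W.IsGloballyMinimal], ¬ W.HasCM → W.analyticRank = 0 →
      Addv W 2 → 0 ≤ padicValRat 2 W.j → MissingLowerBoundAt W 2) :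
    ∀ (W : WeierstrassCurve ℚ) [W.IsElliptic] [W.IsGloballyMinimal], ¬ W.HasCM → W.analyticRank = 0 →
      Addv W 2 → 0 ≤ padicValRat 2 W.j → BSDp W 2 := by
  intro W _ _ hcm hr hadd hj
  have hr1 : W.analyticRank ≤ 1 := by rw [hr]; exact zero_le_one
  exact bsdp_of_missingPPartAt W 2 hGZK hr1
    (missingPPartAt_of_lower_of_upper W 2 (hLow W hcm hr hadd hj)
      (addPotGoodUpper_two_of_conjA_of_rest hGZK hmod hmodN hLim2 hFW hCassels hCT hSharp hin hAna hRest W hcm hr hadd hj))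

/-- **The glue of §3 is not lossy: GRANTED the Kato half, BSD₂ on the additive potentially-good class is EQUIVALENT to
its Eisenstein half** (`BSDp ⟹ MissingLowerBoundAt` by `missingPPartAt_of_bsdp`, `Ш` finite by GZK in analytic rank `0`).
So (I3″) `hLow` of `additiveRankZeroAtTwo_of_residual_v4` is exactly what the crux asserts on this class beyond the Kato
half — the weakest sufficient `∀`-object. Bookkeeping. [cite: Miller2011LMS, §1 and Def. 1.1] -/
theorem addPotGood_bsdp_two_iff_lower_of_kato
    (hGZK : rank_eq_analyticRank_of_analyticRank_le_one) (hmod : hasEntireLFunction_rat) (hmodN : exists_isNewformOf)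
    (hLim2 : Lim2017.thm35_at_two_fineSelmerDual_moduleFinite_of_classicalMuVanishes_of_le_divisionField_four)
    (hFW : ferreroWashington1979_classicalMuVanishes)
    (hCassels : bsdRHS_eq_of_isIsogenous) (hCT : exists_casselsTate_pairing (K := ℚ))
    (hSharp : Kato2004.rankZero_padicValNat_sha_add_padicValNat_tamagawa_le_at_two_of_irreducible_of_fineSelmerDual_fg)
    (hin : Kato2004.exists_memberHullInputs_two)
    (hAna : ∀ (W : WeierstrassCurve ℚ) [W.IsElliptic] [W.IsGloballyMinimal], ¬ W.HasCM → W.analyticRank = 0 →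
      Addv W 2 → 0 ≤ padicValRat 2 W.j → ¬ IsAbelianGalois ℚ (W.divisionField 2) →
      ∀ (κ : ZpExtension ℚ 2), κ.IsCyclotomic →
        ∃ (γ : Field.absoluteGaloisGroup ℚ) (D : W.FineSelmerDualData κ γ),
          Module.Finite ℤ_[2] (RestrictScalars ℤ_[2] (IwasawaAlgebra 2) D.X))
    (hRest : ∀ (W : WeierstrassCurve ℚ) [W.IsElliptic] [W.IsGloballyMinimal], ¬ W.HasCM → W.analyticRank = 0 →
      Addv W 2 → 0 ≤ padicValRat 2 W.j → ¬ W.HasIrreducibleModPGaloisRep 2 →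
      ¬ ((∀ (W' : WeierstrassCurve ℚ) [W'.IsElliptic], IsIsogenous W W' → ¬ 2 ^ 2 ∣ W'.torsionOrder) ∧
          (∀ q : ℚ, shaAn W = (q : ℂ) → Even (padicValRat 2 q))) →
      MissingUpperBoundAt W 2) :
    (∀ (W : WeierstrassCurve ℚ) [W.IsElliptic] [W.IsGloballyMinimal], ¬ W.HasCM → W.analyticRank = 0 →
      Addv W 2 → 0 ≤ padicValRat 2 W.j → BSDp W 2) ↔
    (∀ (W : WeierstrassCurve ℚ) [W.IsElliptic] [W.IsGloballyMinimal], ¬ W.HasCM → W.analyticRank = 0 →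
      Addv W 2 → 0 ≤ padicValRat 2 W.j → MissingLowerBoundAt W 2) := by
  haveI : Fact (Nat.Prime 2) := ⟨Nat.prime_two⟩
  constructor
  · intro h W _ _ hcm hr hadd hj
    have hr1 : W.analyticRank ≤ 1 := by rw [hr]; exact zero_le_one
    haveI : Finite W.sha := (hGZK W hr1).2
    exact (lower_and_upper_of_missingPPartAt W 2 (missingPPartAt_of_bsdp W 2 (h W hcm hr hadd hj))).1
  · exact addPotGood_bsdp_two_of_kato_of_lower hGZK hmod hmodN hLim2 hFW hCassels hCT hSharp hin hAna hRest

/-! ## §4 The potentially MULTIPLICATIVE sub-class: ONE sibling + lane A's over-`K` stub restricted -/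

/-- **BSD₂ on the additive potentially-multiplicative sub-class at `2` from the SINGLE sibling crux
`MultiplicativeRankZeroAtTwo` and lane A's over-`K` stub restricted to `ord₂ j < 0`.** For `W` non-CM, globally minimal,
`r_an = 0`, additive at `2` with `ord₂ j < 0`: `W` is quadratically semistabilisable (`quadSemistabilisable_of_potMult`),
Hoffstein–Luo (`hHL`, through `existsSemistabilisingNonvanishingTwist_of_hoffsteinLuo`) supplies a quadratic `K` with
`W^{(d_K)}` semistable at `2` and `L(W^{(d_K)},1) ≠ 0`; a minimal model `Wd` of that twist is non-CM, `r_an = 0` and — by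
§1 — MULTIPLICATIVE at `2`, so `hMult` gives `BSD₂(Wd)`; Milne's any-model identity (`hMilneC`) descends the over-`K` input
`hQKm` (`bsdp_of_pPartOverC_baseChange`). Conditional; closes nothing.
[cite: Milne1972ArithmeticAV, §1 Thm. 1 (through DokchitserDokchitserAnnals2010 §2.1)] [cite: HoffsteinLuo1997, Theorem]
[cite: SilvermanAEC2009, Prop. VII.5.5] -/
theorem addPotMult_bsdp_two_of_mult_of_overKC
    (hGZK : rank_eq_analyticRank_of_analyticRank_le_one) (hmod : hasEntireLFunction_rat)
    (hMilneC : Milne1972.bsdQuotient_baseChange_quadratic_anyModel)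
    (hHL : HoffsteinLuo1997_exists_twist_L_one_ne_zero)
    (hMult : MultiplicativeRankZeroAtTwo)
    (hQKm : ∀ (W : WeierstrassCurve ℚ) [W.IsElliptic] [W.IsGloballyMinimal], ¬ W.HasCM → W.analyticRank = 0 →
      Addv W 2 → padicValRat 2 W.j < 0 → ∀ (K : Type) [Field K] [NumberField K], Module.finrank ℚ K = 2 →
        SemistableTwistAtTwo W K → (W.quadraticTwist (NumberField.discr K : ℚ)).entireLFunction 1 ≠ 0 →
          MissingPPartOverCAt (W.baseChange K) 2) :
    ∀ (W : WeierstrassCurve ℚ) [W.IsElliptic] [W.IsGloballyMinimal], ¬ W.HasCM → W.analyticRank = 0 →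
      Addv W 2 → padicValRat 2 W.j < 0 → BSDp W 2 := by
  intro W _ _ hcm hr hadd hj
  haveI : Fact (Nat.Prime 2) := ⟨Nat.prime_two⟩
  have hq : QuadSemistabilisable W := quadSemistabilisable_of_potMult W ⟨hadd, hj⟩
  obtain ⟨K, _, _, h2, hst, hL⟩ := Theorems.existsSemistabilisingNonvanishingTwist_of_hoffsteinLuo hHL W hq
  obtain ⟨Wd, _, _, hWd, hcmd, hrd, hred⟩ := Theorems.exists_minimalTwist_semistable_rankZero W hcm K hst hL
  have hd : (NumberField.discr K : ℚ) ≠ 0 := by exact_mod_cast NumberField.discr_ne_zero K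
  have hm : Mult Wd 2 := mult_of_semistableTwist_of_padicValRat_j_neg W hj hd Wd hWd hred
  exact bsdp_of_pPartOverC_baseChange W 2 K Wd hGZK hmod hMilneC (by omega) h2 hWd (by omega)
    (hQKm W hcm hr hadd hj K h2 hst hL) (hMult Wd hcmd hrd hm)

/-! ## §5 The crux BY NAME, ONE-SIDED (glue v4) -/

/-- **The crux `AdditiveRankZeroAtTwo` (item stmt-BirchSwinnertonDyer-19098; type = the route decl verbatim) from its
ONE-SIDED residual, v4.** Inputs: PRINT {`hGZK`, `hmod`, `hmodN`, `hMilneC`, `hHL`, `hLim2`, `hFW`, `hCassels`, `hCT`} +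
READINGS {`hSharp` (D-audit PASS), `hin` (D-audit owed)} + the SINGLE sibling crux `hMult` (`MultiplicativeRankZeroAtTwo`,
item 19096, by name) + the research-grade `∀`-objects (I1″) `hAna` — statement (A) of Coates–Sujatha at `(W,2)` on the
non-CM `r_an = 0` curves additive and potentially good at `2` whose `2`-division field is NOT abelian over `ℚ`; (I2″)
`hRest` — the upper half on the reducible potentially-good curves failing the two side conditions of Kato's member door;
(I3″) `hLow` — the EISENSTEIN HALF `MissingLowerBoundAt W 2` over `ℚ` on the additive potentially-good `r_an = 0` class;
(I4″) `hQKm` — lane A's over-`K` stub on the potentially-multiplicative sub-class only. Split by the sign of `ord₂ j`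
(§3 / §4). Versus v3 (GEN 10): no `hKC`, no `hMM`, no `hOrd`/`hSS`; the quadratic potentially-good sub-class (`Φ = C₂`)
moves from lane A's over-`K` stub to «Kato half + Eisenstein half over `ℚ`». Conditional (audit `proof.conditional`);
the item is NOT closed by this theorem. [cite: Kato2004Asterisque, Thm. 12.6 (p. 222), §14.14 (p. 243), Prop. 14.16 (2) (p. 244)]
[cite: CoatesSujatha2005, statement (A)] [cite: Lim2017FineSelmer, §3 Thm. 3.5] [cite: Milne1972ArithmeticAV, Thm. 1]
[cite: HoffsteinLuo1997, Theorem] [cite: Cassels1965ArithmeticVIII] [cite: SilvermanAEC2009, Thm. X.4.14] [cite: Miller2011LMS, Def. 1.1] -/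
theorem additiveRankZeroAtTwo_of_residual_v4
    (hGZK : rank_eq_analyticRank_of_analyticRank_le_one) (hmod : hasEntireLFunction_rat) (hmodN : exists_isNewformOf)
    (hMilneC : Milne1972.bsdQuotient_baseChange_quadratic_anyModel)
    (hHL : HoffsteinLuo1997_exists_twist_L_one_ne_zero)
    (hLim2 : Lim2017.thm35_at_two_fineSelmerDual_moduleFinite_of_classicalMuVanishes_of_le_divisionField_four)
    (hFW : ferreroWashington1979_classicalMuVanishes)
    (hCassels : bsdRHS_eq_of_isIsogenous) (hCT : exists_casselsTate_pairing (K := ℚ))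
    (hSharp : Kato2004.rankZero_padicValNat_sha_add_padicValNat_tamagawa_le_at_two_of_irreducible_of_fineSelmerDual_fg)
    (hin : Kato2004.exists_memberHullInputs_two)
    (hMult : MultiplicativeRankZeroAtTwo)
    (hAna : ∀ (W : WeierstrassCurve ℚ) [W.IsElliptic] [W.IsGloballyMinimal], ¬ W.HasCM → W.analyticRank = 0 →
      Addv W 2 → 0 ≤ padicValRat 2 W.j → ¬ IsAbelianGalois ℚ (W.divisionField 2) →
      ∀ (κ : ZpExtension ℚ 2), κ.IsCyclotomic →
        ∃ (γ : Field.absoluteGaloisGroup ℚ) (D : W.FineSelmerDualData κ γ),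
          Module.Finite ℤ_[2] (RestrictScalars ℤ_[2] (IwasawaAlgebra 2) D.X))
    (hRest : ∀ (W : WeierstrassCurve ℚ) [W.IsElliptic] [W.IsGloballyMinimal], ¬ W.HasCM → W.analyticRank = 0 →
      Addv W 2 → 0 ≤ padicValRat 2 W.j → ¬ W.HasIrreducibleModPGaloisRep 2 →
      ¬ ((∀ (W' : WeierstrassCurve ℚ) [W'.IsElliptic], IsIsogenous W W' → ¬ 2 ^ 2 ∣ W'.torsionOrder) ∧
          (∀ q : ℚ, shaAn W = (q : ℂ) → Even (padicValRat 2 q))) →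
      MissingUpperBoundAt W 2)
    (hLow : ∀ (W : WeierstrassCurve ℚ) [W.IsElliptic] [W.IsGloballyMinimal], ¬ W.HasCM → W.analyticRank = 0 →
      Addv W 2 → 0 ≤ padicValRat 2 W.j → MissingLowerBoundAt W 2)
    (hQKm : ∀ (W : WeierstrassCurve ℚ) [W.IsElliptic] [W.IsGloballyMinimal], ¬ W.HasCM → W.analyticRank = 0 →
      Addv W 2 → padicValRat 2 W.j < 0 → ∀ (K : Type) [Field K] [NumberField K], Module.finrank ℚ K = 2 →
        SemistableTwistAtTwo W K → (W.quadraticTwist (NumberField.discr K : ℚ)).entireLFunction 1 ≠ 0 →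
          MissingPPartOverCAt (W.baseChange K) 2) :
    Summit.BirchSwinnertonDyer.BirchSwinnertonDyer.Theses.ByReductionTypeAtTwo.AdditiveRankZeroAtTwo := by
  unfold Summit.BirchSwinnertonDyer.BirchSwinnertonDyer.Theses.ByReductionTypeAtTwo.AdditiveRankZeroAtTwo
  intro W _ _ hcm hr hadd
  by_cases hj : 0 ≤ padicValRat 2 W.j
  · exact addPotGood_bsdp_two_of_kato_of_lower hGZK hmod hmodN hLim2 hFW hCassels hCT hSharp hin hAna hRest hLow
      W hcm hr hadd hj
  · exact addPotMult_bsdp_two_of_mult_of_overKC hGZK hmod hMilneC hHL hMult hQKm W hcm hr hadd (lt_of_not_ge hj)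

end Summit.BirchSwinnertonDyer.BirchSwinnertonDyer.Theorems.AddKatoTwo

end
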